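/-
Copyright: the b2b-balaban T⁴-continuum CRUX team, row NE7b leaf lineage `t4-ne7b-formalise-leaf-05` (gen 158). Project licence.
-/
import Summits.QuantumFields.BalabanUV.T4Continuum.Spine.NE7b.AdmissibleFloorSeminormIMS

/-!
# THE (pert) AND (iso) LETTERS OF THE (h2) SLOT FOR LINEAR LOCAL TERMS, FROM ONE SUB-LETTER EACH: covariant terms `T_j x = Σ_{c∈inc j} R_{j,c}(x c)`
# against their flat twins `T⁰_j x = Σ_{c∈inc j} R⁰_{j,c}(x c)` with `‖R_{j,c}v − R⁰_{j,c}v‖ ≤ η‖v‖` give `|‖T_j x‖ − ‖T⁰_j x‖| ≤ η·Σ_{c∈inc j}‖x c‖`, hence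
# `Σ_j(‖T_j x‖ − ‖T⁰_j x‖)² ≤ η²ab·Σ_c‖x c‖²` and the (pert) letter `(Σ_j‖T⁰_j x‖²)∕2 − η²ab·Σ_c‖x c‖² ≤ Σ_j‖T_j x‖²` — ONE family or TWO (`δ = η₁²a₁b₁ + η₂²a₂b₂`),
# in ANY norm currency on the values (row NE7b, node U5c; residual (R2′) family (2), letter (ℓ1); junction lemmas)

Cell `pub-balaban`, sub-cell `t4`, spine estimate NE7b (`T4WeightBudget.RelWeightBound`; the cell's OWN estimate — NOT PRINTED in [Bałaban 1983–89],
NOT PROVED).  Crux-route work under `Spine/NE7b/`; NOTHING of Bałaban's is asserted; no `def`; zero `sorry`; no `T4Continuum/Support` leaf (FREEZE (0)).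
Import: this lineage's `…AdmissibleFloorSeminormIMS` (AFSI §3 `half_sub_le_of_sqrt_letter`; it re-exports `…SqrtFormPerturbationLetters` (SFPL), whose
`pert_letter_of_local` is the plaquette–bond double count).

WHY.  AFST §3 ∕ AFS2 §3 (`admissible_floor_linear_terms(_two)`) take per cube five letters; two of them have a UNIFORM discharge for linear local terms that
no file states: (pert) `F⁰_s Y∕2 − δN′_s Y ≤ F′_s Y` — in the instance `F′ = Σ_j‖T_j Y‖²` (covariant curls AND covariant block averages, transports `R(w)`),
`F⁰ = Σ_j‖T⁰_j Y‖²` (the flat ones, `w = 1`) — and (iso) `N′(uX) = N(X)` for a gauge acting bondwise by isometries.  Leaf-02's CCTL §2 (`abs_X_sub_X1_le`,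
`sum_sq_X_sub_X1_le`) is the (pert) discharge for the CURL family at `k = 1` in [B7]'s operator currency, written on the four explicit plaquette terms; the
AVERAGE family («◐ (pert) average terms», memo `H2-CURRENCY-JUNCTION-g157.md` §2) and the Hilbert–Schmidt reading (HSCL `frobenius_norm_conj_sub_le`) would
each need the same twenty lines again.  THIS FILE does it once for arbitrary linear local terms: the only input is the transport sub-letter
`‖R_{j,c}v − R⁰_{j,c}v‖ ≤ η‖v‖` (op: `B7Prop3GeneralLinearBound.norm_conjR_sub_self_le` with CCTL §1's `‖w − 1‖ ≤ 4τ` ⇒ `η = 8τ`; HS: HSCL §2 ⇒ `η = 2·dist1`;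
averages: the same per path transport, weight inside `R`), and the output is VERBATIM the `hpert` binder of AFST §3 ∕ AFS2 §3 with `δ = η²ab` (resp. `Σ_i η_i²a_ib_i`).

WHAT IS PROVED ([folklore]; bond fields `x : C → W`, `W`, `V`, `V₁`, `V₂` real normed spaces):
* §1 **`abs_norm_term_sub_le`** — `‖R_{j,c}v − R⁰_{j,c}v‖ ≤ η‖v‖` on `inc j` ⊢ `|‖Σ_{c∈inc j}R_{j,c}(x c)‖ − ‖Σ_{c∈inc j}R⁰_{j,c}(x c)‖| ≤ η·Σ_{c∈inc j}‖x c‖`.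
* §2 **`pert_letter_of_linear_terms`** — + `#inc j ≤ a`, `#{j : c ∈ inc j} ≤ b` ⊢ `Σ_j(‖T_j x‖ − ‖T⁰_j x‖)² ≤ η²ab·Σ_c‖x c‖²` (SFPL `pert_letter_of_local` BY NAME on
  `B := (‖x ·‖)`); **`half_flat_le_of_linear_terms`** — ⊢ `(Σ_j‖T⁰_j x‖²)∕2 − η²ab·Σ_c‖x c‖² ≤ Σ_j‖T_j x‖²` (AFSI `half_sub_le_of_sqrt_letter` BY NAME): the
  (pert) binder with `δ = η²ab`.
* §3 **`half_flat_le_of_linear_terms_two`** — two families (`inc_i, R^i, R⁰^i, η_i, a_i, b_i`, values in `V₁`, `V₂`) on the same bond field ⊢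
  `(Σ‖T⁰¹‖² + Σ‖T⁰²‖²)∕2 − (η₁²a₁b₁ + η₂²a₂b₂)·Σ_c‖x c‖² ≤ Σ‖T¹‖² + Σ‖T²‖²` — AFS2 §3's `hpert` for the full form.
* §4 (iso) **`sum_normSq_of_bond_isometries`** — `u x c = U_c(x c)` with `‖U_c v‖ = ‖v‖` ⊢ `Σ_c‖u x c‖² = Σ_c‖x c‖²`; `sum_normSq_smul_of_bond_isometries` (the same
  on a localised field `h_s•x`, the shape AFST §3's `hiso` has when `u_s` is linear bondwise).
* §5 toy: one term on one bond, `R = 2·id`, `R⁰ = id` on `ℝ` (`η = 1`, `a = b = 1`): `(‖x‖²)∕2 − ‖x‖² ≤ ‖2x‖²` (`example`).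

NOT HERE (honest): the transports' sizes BY VALUE (`τ`, CCTL §1 ∕ LGTS; the average family's path transports), (cov), (adm), (flat), the choice of currency
(Q-leaf05-g157-1, OWNER); (A3) ∕ (A1c); NC-NE7b-α UNRULED.  BY-NAME EFFECT ON THE WALL: NONE (two of the (h2) slot's five per-cube letters reduced to transport
sub-letters; the wall is (R2)).  NE7b NOT PRINTED ∕ NOT PROVED; spine PROVED 0∕9; rung (B)+1 on ONE finite T⁴ — NOT infinite volume, NOT the mass gap, NOT Clay.
HONEST DEPENDENCY: continuum YM on T⁴ ⇐ BetaPertH ∧ nine spine estimates (0/9 proved); BetaPertH ⇐ (D1) ∧ (D4) ∧ CAP+tail; G-an2-4 gates asym, D1 and NE2/3/4.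
-/

set_option autoImplicit false

noncomputable section

open Finset Matrix
open Summit.QuantumFields.BalabanUV.T4Continuum.NE7b.AdmissibleFloorSeminormIMS (half_sub_le_of_sqrt_letter)
open Summit.QuantumFields.BalabanUV.T4Continuum.NE7b.SqrtFormPerturbationLetters (pert_letter_of_local)

namespace Summit.QuantumFields.BalabanUV.T4Continuum.NE7b.AdmissibleFloorPerturbationTerms

variable {J J₂ C : Type*} [Fintype J] [Fintype J₂] [Fintype C]
variable {W V V₂ : Type*} [NormedAddCommGroup W] [NormedSpace ℝ W] [NormedAddCommGroup V] [NormedSpace ℝ V]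
  [NormedAddCommGroup V₂] [NormedSpace ℝ V₂]

/-! ## §1 The pointwise letter: a covariant term against its flat twin -/

omit [Fintype J] [Fintype J₂] [Fintype C] [NormedAddCommGroup V₂] [NormedSpace ℝ V₂] in
/-- **`|‖T_j x‖ − ‖T⁰_j x‖| ≤ η·Σ_{c∈inc j}‖x c‖`** for `T_j x = Σ_{c∈inc j}R_{j,c}(x c)`, `T⁰_j x = Σ_{c∈inc j}R⁰_{j,c}(x c)` with the transport sub-letter
`‖R_{j,c}v − R⁰_{j,c}v‖ ≤ η‖v‖` on `inc j` (`|‖a‖ − ‖b‖| ≤ ‖a − b‖`, then term by term). [folklore] -/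
theorem abs_norm_term_sub_le (inc : J → Finset C) (R R0 : J → C → W →ₗ[ℝ] V) {η : ℝ}
    (hRR : ∀ j, ∀ c ∈ inc j, ∀ v, ‖R j c v - R0 j c v‖ ≤ η * ‖v‖) (x : C → W) (j : J) :
    |‖∑ c ∈ inc j, R j c (x c)‖ - ‖∑ c ∈ inc j, R0 j c (x c)‖| ≤ η * ∑ c ∈ inc j, ‖x c‖ := by
  refine (abs_norm_sub_norm_le _ _).trans ?_
  rw [← Finset.sum_sub_distrib, Finset.mul_sum]
  refine (norm_sum_le _ _).trans (Finset.sum_le_sum fun c hc => ?_)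
  exact hRR j c hc (x c)

/-! ## §2 The (pert) letter for one family of linear local terms -/

omit [Fintype J₂] [NormedAddCommGroup V₂] [NormedSpace ℝ V₂] in
/-- **`Σ_j(‖T_j x‖ − ‖T⁰_j x‖)² ≤ η²ab·Σ_c‖x c‖²`** — §1 fed to SFPL `pert_letter_of_local` (the plaquette–bond double count) on the scalar field `c ↦ ‖x c‖`,
with `#inc j ≤ a` and `#{j : c ∈ inc j} ≤ b`. [folklore] -/
theorem pert_letter_of_linear_terms [DecidableEq C] (inc : J → Finset C) (R R0 : J → C → W →ₗ[ℝ] V) {η : ℝ}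
    (hRR : ∀ j, ∀ c ∈ inc j, ∀ v, ‖R j c v - R0 j c v‖ ≤ η * ‖v‖)
    {a b : ℕ} (ha : ∀ j, (inc j).card ≤ a) (hb : ∀ c, (Finset.univ.filter fun j => c ∈ inc j).card ≤ b) (x : C → W) :
    ∑ j, (‖∑ c ∈ inc j, R j c (x c)‖ - ‖∑ c ∈ inc j, R0 j c (x c)‖) ^ 2 ≤ η ^ 2 * a * b * ∑ c, ‖x c‖ ^ 2 := by
  have h := pert_letter_of_local inc (fun j (_ : C → ℝ) => ‖∑ c ∈ inc j, R j c (x c)‖)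
    (fun j (_ : C → ℝ) => ‖∑ c ∈ inc j, R0 j c (x c)‖) ha hb (fun c => ‖x c‖)
    (fun j => by simpa only [abs_norm] using abs_norm_term_sub_le inc R R0 hRR x j)
  have e : (fun c => ‖x c‖) ⬝ᵥ (fun c => ‖x c‖) = ∑ c, ‖x c‖ ^ 2 := by
    simp only [dotProduct, pow_two]
  simpa only [e] using h

omit [Fintype J₂] [NormedAddCommGroup V₂] [NormedSpace ℝ V₂] in
/-- **THE (pert) BINDER FOR LINEAR LOCAL TERMS**: `(Σ_j‖T⁰_j x‖²)∕2 − η²ab·Σ_c‖x c‖² ≤ Σ_j‖T_j x‖²` — AFSI `half_sub_le_of_sqrt_letter` on §2; this is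
AFST §3's `hpert` with `F′ := Σ_j‖T_j ·‖²`, `F⁰ := Σ_j‖T⁰_j ·‖²`, `N′ := Σ_c‖· c‖²`, `δ := η²ab` (on every field, no `good⁰` needed). [folklore] -/
theorem half_flat_le_of_linear_terms [DecidableEq C] (inc : J → Finset C) (R R0 : J → C → W →ₗ[ℝ] V) {η : ℝ}
    (hRR : ∀ j, ∀ c ∈ inc j, ∀ v, ‖R j c v - R0 j c v‖ ≤ η * ‖v‖)
    {a b : ℕ} (ha : ∀ j, (inc j).card ≤ a) (hb : ∀ c, (Finset.univ.filter fun j => c ∈ inc j).card ≤ b) (x : C → W) :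
    (∑ j, ‖∑ c ∈ inc j, R0 j c (x c)‖ ^ 2) / 2 - η ^ 2 * a * b * ∑ c, ‖x c‖ ^ 2 ≤ ∑ j, ‖∑ c ∈ inc j, R j c (x c)‖ ^ 2 :=
  half_sub_le_of_sqrt_letter (fun j (y : C → W) => ‖∑ c ∈ inc j, R j c (y c)‖)
    (fun j (y : C → W) => ‖∑ c ∈ inc j, R0 j c (y c)‖) (fun y => ∑ c, ‖y c‖ ^ 2) x
    (pert_letter_of_linear_terms inc R R0 hRR ha hb x)

/-! ## §3 The (pert) letter for two families (the full form: curls and averages) -/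

/-- **THE (pert) BINDER FOR TWO FAMILIES OF LINEAR LOCAL TERMS** on the same bond field (values in `V` and `V₂`, transport sub-letters `η₁`, `η₂`, counts
`a_i, b_i`): `(Σ_j‖T⁰¹_j x‖² + Σ_j‖T⁰²_j x‖²)∕2 − (η₁²a₁b₁ + η₂²a₂b₂)·Σ_c‖x c‖² ≤ Σ_j‖T¹_j x‖² + Σ_j‖T²_j x‖²` — §2 twice, added; AFS2 §3's `hpert` for the
full local form with `δ := η₁²a₁b₁ + η₂²a₂b₂`. [folklore] -/
theorem half_flat_le_of_linear_terms_two [DecidableEq C]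
    (inc₁ : J → Finset C) (R₁ R0₁ : J → C → W →ₗ[ℝ] V) {η₁ : ℝ}
    (hRR₁ : ∀ j, ∀ c ∈ inc₁ j, ∀ v, ‖R₁ j c v - R0₁ j c v‖ ≤ η₁ * ‖v‖)
    {a₁ b₁ : ℕ} (ha₁ : ∀ j, (inc₁ j).card ≤ a₁) (hb₁ : ∀ c, (Finset.univ.filter fun j => c ∈ inc₁ j).card ≤ b₁)
    (inc₂ : J₂ → Finset C) (R₂ R0₂ : J₂ → C → W →ₗ[ℝ] V₂) {η₂ : ℝ}
    (hRR₂ : ∀ j, ∀ c ∈ inc₂ j, ∀ v, ‖R₂ j c v - R0₂ j c v‖ ≤ η₂ * ‖v‖)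
    {a₂ b₂ : ℕ} (ha₂ : ∀ j, (inc₂ j).card ≤ a₂) (hb₂ : ∀ c, (Finset.univ.filter fun j => c ∈ inc₂ j).card ≤ b₂)
    (x : C → W) :
    (∑ j, ‖∑ c ∈ inc₁ j, R0₁ j c (x c)‖ ^ 2 + ∑ j, ‖∑ c ∈ inc₂ j, R0₂ j c (x c)‖ ^ 2) / 2
        - (η₁ ^ 2 * a₁ * b₁ + η₂ ^ 2 * a₂ * b₂) * ∑ c, ‖x c‖ ^ 2
      ≤ ∑ j, ‖∑ c ∈ inc₁ j, R₁ j c (x c)‖ ^ 2 + ∑ j, ‖∑ c ∈ inc₂ j, R₂ j c (x c)‖ ^ 2 := by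
  have h1 := half_flat_le_of_linear_terms inc₁ R₁ R0₁ hRR₁ ha₁ hb₁ x
  have h2 := half_flat_le_of_linear_terms inc₂ R₂ R0₂ hRR₂ ha₂ hb₂ x
  have e : (∑ j, ‖∑ c ∈ inc₁ j, R0₁ j c (x c)‖ ^ 2 + ∑ j, ‖∑ c ∈ inc₂ j, R0₂ j c (x c)‖ ^ 2) / 2
        - (η₁ ^ 2 * a₁ * b₁ + η₂ ^ 2 * a₂ * b₂) * ∑ c, ‖x c‖ ^ 2
      = ((∑ j, ‖∑ c ∈ inc₁ j, R0₁ j c (x c)‖ ^ 2) / 2 - η₁ ^ 2 * a₁ * b₁ * ∑ c, ‖x c‖ ^ 2)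
        + ((∑ j, ‖∑ c ∈ inc₂ j, R0₂ j c (x c)‖ ^ 2) / 2 - η₂ ^ 2 * a₂ * b₂ * ∑ c, ‖x c‖ ^ 2) := by ring
  rw [e]
  exact add_le_add h1 h2

/-! ## §4 The (iso) letter: a gauge acting bondwise by isometries preserves `Σ_c‖x c‖²` -/

omit [Fintype J] [Fintype J₂] [NormedSpace ℝ W] [NormedSpace ℝ V] [NormedAddCommGroup V₂] [NormedSpace ℝ V₂] in
/-- **(iso)**: `u x c = U_c(x c)` with `‖U_c v‖ = ‖v‖` for every bond ⊢ `Σ_c‖u x c‖² = Σ_c‖x c‖²` (rotations `R(g)` on `U1`: `B8Ineq132.norm_conjR`; unitary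
conjugation in HS: `UNGauss.frob_norm_unitary_conj`). [folklore] -/
theorem sum_normSq_of_bond_isometries (U : C → W → V) (hU : ∀ c v, ‖U c v‖ = ‖v‖) (x : C → W) :
    ∑ c, ‖U c (x c)‖ ^ 2 = ∑ c, ‖x c‖ ^ 2 :=
  Finset.sum_congr rfl fun c _ => by rw [hU c]

omit [Fintype J] [Fintype J₂] [NormedSpace ℝ V] [NormedAddCommGroup V₂] [NormedSpace ℝ V₂] in
/-- (iso) on a localised field: `Σ_c‖U_c(h_s(c)•x(c))‖² = Σ_c‖h_s(c)•x(c)‖²` — AFST §3's `hiso` VERBATIM for `u_s x := (c ↦ U_c(x c))` applied to `h_s•x`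
and `N′_s := Σ_c‖· c‖²`. [folklore] -/
theorem sum_normSq_smul_of_bond_isometries (U : C → W → V) (hU : ∀ c v, ‖U c v‖ = ‖v‖) (h : C → ℝ) (x : C → W) :
    ∑ c, ‖U c (h c • x c)‖ ^ 2 = ∑ c, ‖h c • x c‖ ^ 2 :=
  sum_normSq_of_bond_isometries U hU fun c => h c • x c

/-! ## §5 Toy: one term on one bond, `R = 2·id` against `R⁰ = id` on `ℝ` -/

section Toy

/- `J = C = Unit`, `W = V = ℝ`, `inc _ = {()}`, `R = 2•id`, `R⁰ = id` (`‖2v − v‖ = ‖v‖`, `η = 1`), `a = b = 1`: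
`(‖x ()‖²)∕2 − 1·‖x ()‖² ≤ ‖2•x ()‖²`. -/
example (x : Unit → ℝ) :
    (∑ _j : Unit, ‖∑ c ∈ ({()} : Finset Unit), (LinearMap.id : ℝ →ₗ[ℝ] ℝ) (x c)‖ ^ 2) / 2
        - (1 : ℝ) ^ 2 * (1 : ℕ) * (1 : ℕ) * ∑ c, ‖x c‖ ^ 2
      ≤ ∑ _j : Unit, ‖∑ c ∈ ({()} : Finset Unit), ((2 : ℝ) • (LinearMap.id : ℝ →ₗ[ℝ] ℝ)) (x c)‖ ^ 2 :=
  half_flat_le_of_linear_terms (J := Unit) (C := Unit) (W := ℝ) (V := ℝ) (fun _ => {()})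
    (fun _ _ => (2 : ℝ) • LinearMap.id) (fun _ _ => LinearMap.id) (η := 1)
    (fun _ _ _ v => by simp [two_smul])
    (a := 1) (b := 1) (fun _ => by simp) (fun _ => by simp) x

end Toy

end Summit.QuantumFields.BalabanUV.T4Continuum.NE7b.AdmissibleFloorPerturbationTerms

end
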